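import Mathlib
import Literature.Analysis.FluidPDE.LocalHelmholtzSupBound
import Summits.NavierStokesRegularity.NavierStokesRegularity.Theses.SlicedKelvin

/-!
# Crux `SlicedKelvin.FluxZoom` (stmt-NavierStokesRegularity-15603), line `registered`,
# stub `stub_unitScaleVelocity`: the unit-scale velocity bound at bounded planar flux

Support file (theorems only, `--supports stmt-NavierStokesRegularity-15603`) for the lead's
skeleton of the crux `FluxZoom` of route `SlicedKelvin`. The statement of the neighbouring stub
`stub_nearFieldFlux` (the near-field Biot–Savart integral at bounded planar flux: for a continuous
field `ω` with `|ω| ≤ W` and unsigned flux `≤ Φ` through every plane,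
`∫_{B(x,2)} |ω(y)|/|x − y|² dy ≤ 4πrW + 12Φ/r` for `0 < r ≤ 1`) implies the **unit-scale velocity
bound**: there is an absolute constant `C_v ≥ 0` such that every `C²` divergence-free field
`v ∈ L²(ℝ³)` with `|curl v| ≤ W` and planar flux of `curl v` at most `Φ` satisfies, for every `x`
and every `0 < r ≤ 1`,

  `‖v(x)‖ ≤ r W + 3Φ/(π r) + C_v ‖v‖_{L²}`.

No decay of `v` at infinity is assumed.

## Proof

Verbatim the proof of `Literature.Analysis.FluidPDE.exists_norm_sub_biotSavart_le`
(`LocalHelmholtzSupBound.lean`) with `b = 0`, `a = curl v`, and its "bound 1" replaced by the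
near-field flux bound. The local Helmholtz identity at a point (`eq_biotSavart_curl_smul_add`)
with the smooth cutoff `φ = suppCutoff x 1` (`= 1` on `B̄(x,1)`, `= 0` off `B(x,2)`) reads
`v(x) = (K ∗ curl(φv))(x) + Σⱼ (∫ ∂ⱼΓ(x − y) ⟪v(y), ∇φ(y)⟫ dy) eⱼ`, and
`curl(φv) = φ curl v + ∇φ × v` (`curl_smul`).

* Near field: `‖K(x − y)(φ curl v)(y)‖ ≤ (4π)⁻¹ |φ(y)| |curl v(y)| / |x − y|²`
  (`norm_biotSavartKernel_le`), supported in the open ball `B(x, 2)` (`suppCutoff_eq_zero`) where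
  `|φ| ≤ 1`; so `‖(K ∗ (φ curl v))(x)‖ ≤ (4π)⁻¹ ∫_{B(x,2)} |curl v|/|x − y|² ≤ (4π)⁻¹(4πrW + 12Φ/r)
  = rW + 3Φ/(πr)` by the antecedent applied to `ω = curl v`.
* The two cutoff terms (`K ∗ (∇φ × v)` and the gradient term) live on the shell
  `1 ≤ |x − y| ≤ 2`, where `|∇φ| ≤ B` and all kernels are `≤ (4π)⁻¹`, and cost
  `(4π)⁻¹ B |B̄₂|^{1/2} ‖v‖₂` and `3 (4π)⁻¹ B |B̄₂|^{1/2} ‖v‖₂` by Cauchy–Schwarz on the ball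
  (`integral_indicator_closedBall_mul_norm_le`); `C_v = 4 (4π)⁻¹ B |B̄₂|^{1/2}`.

No named fact is assumed: every ingredient is a theorem of Mathlib or of the tree
(`Literature.Analysis.FluidPDE.LocalHelmholtzSupBound` and its imports).

## References

* P. G. Lemarié-Rieusset, *The Navier–Stokes Problem in the 21st Century* (2016), Thm. 11.7
  (proof) [LemarieRieusset2016].
* A. J. Majda, A. L. Bertozzi, *Vorticity and Incompressible Flow* (CUP 2002), §2.4.1
  [MajdaBertozziCUP2002].
-/

noncomputable section

-- the summit and its single sub-problem share the name (CONVENTIONS §1), as in every Theorems file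
set_option linter.dupNamespace false

open MeasureTheory Set Function Filter Metric Real InnerProductSpace
open _root_.Topology
open scoped ENNReal NNReal RealInnerProductSpace

namespace Summit.NavierStokesRegularity.NavierStokesRegularity.Theorems.FluxZoom.Registered

open Literature.Analysis.FluidPDE

/-- **Stub `stub_unitScaleVelocity` of the crux `SlicedKelvin.FluxZoom`, line `registered`.**
The statement of `stub_nearFieldFlux` implies: there is an absolute `C_v ≥ 0` such that every
`C²` divergence-free `v ∈ L²(ℝ³)` with `|curl v| ≤ W` and planar flux of `curl v` `≤ Φ` satisfies,
for every `x` and `0 < r ≤ 1`, `‖v(x)‖ ≤ rW + 3Φ/(πr) + C_v‖v‖_{L²}` (the local Helmholtz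
identity at a point `eq_biotSavart_curl_smul_add`, `curl(φv) = φ curl v + ∇φ × v`; the near field
`K ∗ (φ curl v)(x)` is `≤ (4π)⁻¹ ∫_{B(x,2)} |curl v|/|x − y|²`, the two cutoff terms live on the
shell `1 ≤ |x − y| ≤ 2` and cost `C_v ‖v‖₂` exactly as in `exists_norm_sub_biotSavart_le`). -/
theorem stub_unitScaleVelocity :
    (∀ (ω : EuclideanSpace ℝ (Fin 3) → EuclideanSpace ℝ (Fin 3)), Continuous ω →
      ∀ (W Φ : ℝ), 0 ≤ W → 0 ≤ Φ → (∀ x, ‖ω x‖ ≤ W) →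
        (∀ (R : EuclideanSpace ℝ (Fin 3) ≃ₗᵢ[ℝ] EuclideanSpace ℝ (Fin 3)) (c : ℝ),
          ∫⁻ y : EuclideanSpace ℝ (Fin 2),
            ‖inner ℝ (ω (R (WithLp.toLp 2 ![y 0, y 1, c]))) (R (EuclideanSpace.single 2 1))‖ₑ ≤
              ENNReal.ofReal Φ) →
        ∀ (x : EuclideanSpace ℝ (Fin 3)) (r : ℝ), 0 < r → r ≤ 1 →
          MeasureTheory.IntegrableOn (fun y => ‖ω y‖ / ‖x - y‖ ^ 2) (Metric.ball x 2)
              MeasureTheory.volume ∧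
            ∫ y in Metric.ball x 2, ‖ω y‖ / ‖x - y‖ ^ 2 ≤ 4 * Real.pi * r * W + 12 * Φ / r) →
    ∃ Cv : ℝ, 0 ≤ Cv ∧
      ∀ (v : EuclideanSpace ℝ (Fin 3) → EuclideanSpace ℝ (Fin 3)), ContDiff ℝ 2 v →
        Literature.Analysis.FluidPDE.VectorCalculus.IsDivFree v →
        (∫⁻ y, ‖v y‖ₑ ^ 2 < ⊤) →
        ∀ (W Φ : ℝ), 0 ≤ W → 0 ≤ Φ →
          (∀ x, ‖Literature.Analysis.FluidPDE.curl v x‖ ≤ W) →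
          (∀ (R : EuclideanSpace ℝ (Fin 3) ≃ₗᵢ[ℝ] EuclideanSpace ℝ (Fin 3)) (c : ℝ),
            ∫⁻ y : EuclideanSpace ℝ (Fin 2),
              ‖inner ℝ (Literature.Analysis.FluidPDE.curl v (R (WithLp.toLp 2 ![y 0, y 1, c])))
                (R (EuclideanSpace.single 2 1))‖ₑ ≤ ENNReal.ofReal Φ) →
          ∀ (x : EuclideanSpace ℝ (Fin 3)) (r : ℝ), 0 < r → r ≤ 1 →
            ‖v x‖ ≤ r * W + 3 * Φ / (Real.pi * r) +
              Cv * (MeasureTheory.eLpNorm v 2 MeasureTheory.volume).toReal := by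
  intro hNF
  obtain ⟨B, hB0, hB⟩ := exists_norm_gradient_suppCutoff_le
  set V2 : ℝ := (volume (closedBall (0 : (EuclideanSpace ℝ (Fin 3))) 2)).toReal ^ (1 / (2 : ℝ))
    with hV2
  have hV20 : 0 ≤ V2 := Real.rpow_nonneg ENNReal.toReal_nonneg _
  refine ⟨4 * ((4 * π)⁻¹ * B * V2), by positivity, ?_⟩
  intro v hv hdiv hv2 W Φ hW hΦ hcurl hflux x r hr hr1
  have hv1 : ContDiff ℝ 1 v := hv.of_le (by norm_num)
  have hvc : Continuous v := hv.continuous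
  have hωc : Continuous (curl v) := continuous_curl hv1
  -- the antecedent: the near-field integral of `ω = curl v`
  obtain ⟨hint, hI⟩ := hNF (curl v) hωc W Φ hW hΦ hcurl hflux x r hr hr1
  -- the cutoff and the identity
  set φ : (EuclideanSpace ℝ (Fin 3)) → ℝ := suppCutoff x 1 with hφdef
  have hφ1 : ContDiff ℝ 1 φ := contDiff_suppCutoff' x
  have hφc : HasCompactSupport φ := hasCompactSupport_suppCutoff x one_pos
  have hφcont : Continuous φ := hφ1.continuous
  have hgφ : Continuous (gradient φ) := (contDiff_gradient_suppCutoff x).continuous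
  have hid := eq_biotSavart_curl_smul_add hv hdiv x
  -- the two sources
  set s₁ : (EuclideanSpace ℝ (Fin 3)) → (EuclideanSpace ℝ (Fin 3)) := fun y => φ y • curl v y
    with hs₁
  set s₃ : (EuclideanSpace ℝ (Fin 3)) → (EuclideanSpace ℝ (Fin 3)) :=
    fun y => cross (gradient φ y) (v y) with hs₃
  have hs₁c : Continuous s₁ := hφcont.smul hωc
  have hs₃c : Continuous s₃ := by
    show Continuous fun y => crossCLM (gradient φ y) (v y)
    exact crossCLM.continuous₂.comp (hgφ.prodMk hvc)
  have hs₁s : HasCompactSupport s₁ := by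
    show HasCompactSupport (φ • curl v)
    exact hφc.smul_right
  have hs₃s : HasCompactSupport s₃ := by
    refine (hasCompactSupport_gradient_suppCutoff x).mono ?_
    intro y hy
    rw [mem_support] at hy ⊢
    intro h
    apply hy
    show cross (gradient φ y) (v y) = 0
    rw [hφdef, h, ← crossCLM_apply, map_zero, zero_apply]
  -- the curl of the localised field
  have hcurlW : ∀ y, curl (fun y => suppCutoff x 1 y • v y) y = s₁ y + s₃ y := by
    intro y
    rw [curl_smul ((hφ1.differentiable one_ne_zero) y) ((hv1.differentiable one_ne_zero) y),
      fderiv_eq_innerSL_gradient, curlCLM_smulRight_innerSL, hs₁, hs₃]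
  -- integrability of the Biot–Savart integrands
  have I₁ := integrable_biotSavartKernel_sub_apply_of_hasCompactSupport hs₁c hs₁s x
  have I₃ := integrable_biotSavartKernel_sub_apply_of_hasCompactSupport hs₃c hs₃s x
  have he1 : ∀ j : Fin 3, ‖(EuclideanSpace.single (j : Fin 3) (1 : ℝ))‖ = 1 := fun j => by simp
  -- the decomposition of `v x`
  have hdec : v x =
      (∫ y, biotSavartKernel (x - y) (s₁ y)) + (∫ y, biotSavartKernel (x - y) (s₃ y)) +
        ∑ j, (∫ y, fderiv ℝ newtonKernel (x - y) (EuclideanSpace.single (j : Fin 3) (1 : ℝ)) *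
          ⟪v y, gradient (suppCutoff x 1) y⟫) • (EuclideanSpace.single (j : Fin 3) (1 : ℝ)) := by
    have hdiff : biotSavart (curl fun y => suppCutoff x 1 y • v y) x =
        (∫ y, biotSavartKernel (x - y) (s₁ y)) + ∫ y, biotSavartKernel (x - y) (s₃ y) := by
      rw [biotSavart, ← integral_add I₁ I₃]
      refine integral_congr_ae (Eventually.of_forall fun y => ?_)
      show biotSavartKernel (x - y) (curl (fun y => suppCutoff x 1 y • v y) y) =
        biotSavartKernel (x - y) (s₁ y) + biotSavartKernel (x - y) (s₃ y)
      rw [← biotSavartCLM_apply, ← biotSavartCLM_apply, ← biotSavartCLM_apply, hcurlW, map_add]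
    conv_lhs => rw [hid]
    rw [hdiff]
  -- the common shell majorant for the cutoff terms
  set g₃ : (EuclideanSpace ℝ (Fin 3)) → ℝ :=
    fun y => (4 * π)⁻¹ * B * ((closedBall x 2).indicator (fun _ => (1 : ℝ)) y * ‖v y‖) with hg₃
  have hg₃i : Integrable g₃ := by
    have h1 : Integrable ((closedBall x 2).indicator fun y => ‖v y‖) := by
      rw [integrable_indicator_iff measurableSet_closedBall]
      exact hvc.norm.continuousOn.integrableOn_compact (isCompact_closedBall x 2)
    refine (h1.const_mul ((4 * π)⁻¹ * B)).congr (Eventually.of_forall fun y => ?_)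
    show (4 * π)⁻¹ * B * (closedBall x 2).indicator (fun y => ‖v y‖) y = g₃ y
    rw [hg₃]
    by_cases hy : y ∈ closedBall x 2
    · simp only [indicator_of_mem hy, one_mul]
    · simp only [indicator_of_notMem hy, zero_mul]
  have hg₃int : ∫ y, g₃ y ≤ (4 * π)⁻¹ * B * V2 * (eLpNorm v 2 volume).toReal := by
    rw [hg₃, integral_const_mul, mul_assoc ((4 * π)⁻¹ * B)]
    exact mul_le_mul_of_nonneg_left (integral_indicator_closedBall_mul_norm_le hvc hv2 x)
      (by positivity)
  -- pointwise facts on the shell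
  have hshell : ∀ y, ‖gradient φ y‖ * (‖x - y‖ ^ 2)⁻¹ ≤
      B * (closedBall x 2).indicator (fun _ => (1 : ℝ)) y := by
    intro y
    by_cases h1 : ‖y - x‖ < 1
    · rw [hφdef, gradient_suppCutoff_eq_zero_of_lt h1, norm_zero, zero_mul]
      exact mul_nonneg hB0 (indicator_nonneg (fun _ _ => zero_le_one) y)
    by_cases h2 : 2 < ‖y - x‖
    · rw [hφdef, gradient_suppCutoff_eq_zero_of_two_lt h2, norm_zero, zero_mul]
      exact mul_nonneg hB0 (indicator_nonneg (fun _ _ => zero_le_one) y)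
    · have hy2 : y ∈ closedBall x 2 := by
        rw [mem_closedBall, dist_eq_norm]; exact not_lt.1 h2
      rw [indicator_of_mem hy2, mul_one]
      have hxy : 1 ≤ ‖x - y‖ := by rw [norm_sub_rev]; exact not_lt.1 h1
      have hinv : (‖x - y‖ ^ 2)⁻¹ ≤ 1 := inv_le_one_of_one_le₀ (by nlinarith)
      calc ‖gradient φ y‖ * (‖x - y‖ ^ 2)⁻¹ ≤ B * 1 :=
            mul_le_mul (hB x y) hinv (by positivity) hB0
        _ = B := mul_one B
  -- bound 1: the near field of `φ curl v`, by the antecedent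
  have hb1 : ‖∫ y, biotSavartKernel (x - y) (s₁ y)‖ ≤ r * W + 3 * Φ / (π * r) := by
    have hfi : Integrable ((ball x 2).indicator fun y => ‖curl v y‖ / ‖x - y‖ ^ 2) :=
      (integrable_indicator_iff measurableSet_ball).2 hint
    have hmaj : Integrable fun y =>
        (4 * π)⁻¹ * (ball x 2).indicator (fun y => ‖curl v y‖ / ‖x - y‖ ^ 2) y :=
      hfi.const_mul _
    have hpt : ∀ y, ‖biotSavartKernel (x - y) (s₁ y)‖ ≤
        (4 * π)⁻¹ * (ball x 2).indicator (fun y => ‖curl v y‖ / ‖x - y‖ ^ 2) y := by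
      intro y
      by_cases hy : ‖y - x‖ < 2
      · have hmem : y ∈ ball x 2 := by rw [mem_ball, dist_eq_norm]; exact hy
        rw [indicator_of_mem hmem]
        calc ‖biotSavartKernel (x - y) (s₁ y)‖ ≤ (4 * π)⁻¹ * ‖s₁ y‖ * (‖x - y‖ ^ 2)⁻¹ :=
              norm_biotSavartKernel_le _ _
          _ ≤ (4 * π)⁻¹ * ‖curl v y‖ * (‖x - y‖ ^ 2)⁻¹ := by
              gcongr
              rw [hs₁, norm_smul, Real.norm_eq_abs]
              calc |φ y| * ‖curl v y‖ ≤ 1 * ‖curl v y‖ :=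
                    mul_le_mul_of_nonneg_right (abs_suppCutoff_le_one x 1 y) (norm_nonneg _)
                _ = ‖curl v y‖ := one_mul _
          _ = (4 * π)⁻¹ * (‖curl v y‖ / ‖x - y‖ ^ 2) := by ring
      · have h0 : s₁ y = 0 := by
          rw [hs₁]
          show φ y • curl v y = 0
          rw [hφdef, suppCutoff_eq_zero one_pos (by linarith [not_lt.1 hy]), zero_smul]
        rw [h0, biotSavartKernel_zero_right, norm_zero]
        exact mul_nonneg (by positivity) (indicator_nonneg (fun z _ => by positivity) y)
    refine (norm_integral_le_of_norm_le hmaj (Eventually.of_forall hpt)).trans ?_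
    rw [integral_const_mul, integral_indicator measurableSet_ball]
    calc (4 * π)⁻¹ * ∫ y in ball x 2, ‖curl v y‖ / ‖x - y‖ ^ 2
        ≤ (4 * π)⁻¹ * (4 * π * r * W + 12 * Φ / r) :=
          mul_le_mul_of_nonneg_left hI (by positivity)
      _ = r * W + 3 * Φ / (π * r) := by
          field_simp
          ring
  -- bound 3: the cutoff term of the curl
  have hb3 : ‖∫ y, biotSavartKernel (x - y) (s₃ y)‖ ≤
      (4 * π)⁻¹ * B * V2 * (eLpNorm v 2 volume).toReal := by
    have hpt : ∀ y, ‖biotSavartKernel (x - y) (s₃ y)‖ ≤ g₃ y := by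
      intro y
      calc ‖biotSavartKernel (x - y) (s₃ y)‖ ≤ (4 * π)⁻¹ * ‖s₃ y‖ * (‖x - y‖ ^ 2)⁻¹ :=
            norm_biotSavartKernel_le _ _
        _ ≤ (4 * π)⁻¹ * (‖gradient φ y‖ * ‖v y‖) * (‖x - y‖ ^ 2)⁻¹ := by
            gcongr
            exact norm_cross_le_mul_norm _ _
        _ = (4 * π)⁻¹ * ((‖gradient φ y‖ * (‖x - y‖ ^ 2)⁻¹) * ‖v y‖) := by ring
        _ ≤ (4 * π)⁻¹ * ((B * (closedBall x 2).indicator (fun _ => (1 : ℝ)) y) * ‖v y‖) :=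
            mul_le_mul_of_nonneg_left (mul_le_mul_of_nonneg_right (hshell y) (norm_nonneg _))
              (by positivity)
        _ = g₃ y := by rw [hg₃]; ring
    exact (norm_integral_le_of_norm_le hg₃i (Eventually.of_forall hpt)).trans hg₃int
  -- bound 4: the gradient (pressure-like) term
  have hb4 : ‖∑ j, (∫ y, fderiv ℝ newtonKernel (x - y) (EuclideanSpace.single (j : Fin 3) (1 : ℝ)) *
      ⟪v y, gradient (suppCutoff x 1) y⟫) • (EuclideanSpace.single (j : Fin 3) (1 : ℝ))‖ ≤
      3 * ((4 * π)⁻¹ * B * V2 * (eLpNorm v 2 volume).toReal) := by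
    have hcoef : ∀ j : Fin 3,
        |∫ y, fderiv ℝ newtonKernel (x - y) (EuclideanSpace.single (j : Fin 3) (1 : ℝ)) *
          ⟪v y, gradient (suppCutoff x 1) y⟫| ≤
          (4 * π)⁻¹ * B * V2 * (eLpNorm v 2 volume).toReal := by
      intro j
      have hpt : ∀ y, ‖fderiv ℝ newtonKernel (x - y) (EuclideanSpace.single (j : Fin 3) (1 : ℝ)) *
          ⟪v y, gradient (suppCutoff x 1) y⟫‖ ≤ g₃ y := by
        intro y
        rw [norm_mul, Real.norm_eq_abs, Real.norm_eq_abs]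
        have h1 : |fderiv ℝ newtonKernel (x - y) (EuclideanSpace.single (j : Fin 3) (1 : ℝ))| ≤
            (4 * π * ‖x - y‖ ^ 2)⁻¹ := by
          calc |fderiv ℝ newtonKernel (x - y) (EuclideanSpace.single (j : Fin 3) (1 : ℝ))|
              = ‖fderiv ℝ newtonKernel (x - y) (EuclideanSpace.single (j : Fin 3) (1 : ℝ))‖ :=
                (Real.norm_eq_abs _).symm
            _ ≤ ‖fderiv ℝ newtonKernel (x - y)‖ * ‖(EuclideanSpace.single (j : Fin 3) (1 : ℝ))‖ :=
                ContinuousLinearMap.le_opNorm _ _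
            _ ≤ (4 * π * ‖x - y‖ ^ 2)⁻¹ * 1 := by
                gcongr
                · exact norm_fderiv_newtonKernel_le _
                · rw [he1 j]
            _ = (4 * π * ‖x - y‖ ^ 2)⁻¹ := mul_one _
        have h2 : |⟪v y, gradient (suppCutoff x 1) y⟫| ≤ ‖v y‖ * ‖gradient φ y‖ := by
          rw [hφdef]; exact abs_real_inner_le_norm _ _
        calc |fderiv ℝ newtonKernel (x - y) (EuclideanSpace.single (j : Fin 3) (1 : ℝ))| *
              |⟪v y, gradient (suppCutoff x 1) y⟫|
            ≤ (4 * π * ‖x - y‖ ^ 2)⁻¹ * (‖v y‖ * ‖gradient φ y‖) :=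
              mul_le_mul h1 h2 (abs_nonneg _) (by positivity)
          _ = (4 * π)⁻¹ * ((‖gradient φ y‖ * (‖x - y‖ ^ 2)⁻¹) * ‖v y‖) := by
              rw [mul_inv]; ring
          _ ≤ (4 * π)⁻¹ * ((B * (closedBall x 2).indicator (fun _ => (1 : ℝ)) y) * ‖v y‖) :=
              mul_le_mul_of_nonneg_left (mul_le_mul_of_nonneg_right (hshell y) (norm_nonneg _))
                (by positivity)
          _ = g₃ y := by rw [hg₃]; ring
      have h := norm_integral_le_of_norm_le hg₃i (Eventually.of_forall hpt)
      rw [Real.norm_eq_abs] at h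
      exact h.trans hg₃int
    calc ‖∑ j, (∫ y, fderiv ℝ newtonKernel (x - y) (EuclideanSpace.single (j : Fin 3) (1 : ℝ)) *
          ⟪v y, gradient (suppCutoff x 1) y⟫) • (EuclideanSpace.single (j : Fin 3) (1 : ℝ))‖
        ≤ ∑ j, ‖(∫ y, fderiv ℝ newtonKernel (x - y) (EuclideanSpace.single (j : Fin 3) (1 : ℝ)) *
          ⟪v y, gradient (suppCutoff x 1) y⟫) • (EuclideanSpace.single (j : Fin 3) (1 : ℝ))‖ :=
          norm_sum_le _ _
      _ = ∑ j, |∫ y, fderiv ℝ newtonKernel (x - y) (EuclideanSpace.single (j : Fin 3) (1 : ℝ)) *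
          ⟪v y, gradient (suppCutoff x 1) y⟫| := by
          refine Finset.sum_congr rfl fun j _ => ?_
          rw [norm_smul, Real.norm_eq_abs, he1 j, mul_one]
      _ ≤ ∑ _j : Fin 3, (4 * π)⁻¹ * B * V2 * (eLpNorm v 2 volume).toReal :=
          Finset.sum_le_sum fun j _ => hcoef j
      _ = 3 * ((4 * π)⁻¹ * B * V2 * (eLpNorm v 2 volume).toReal) := by
          rw [Finset.sum_const, Finset.card_univ, Fintype.card_fin]
          simp
  -- assemble
  rw [hdec]
  have e1 := norm_add_le ((∫ y, biotSavartKernel (x - y) (s₁ y)) +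
      (∫ y, biotSavartKernel (x - y) (s₃ y)))
    (∑ j, (∫ y, fderiv ℝ newtonKernel (x - y) (EuclideanSpace.single (j : Fin 3) (1 : ℝ)) *
      ⟪v y, gradient (suppCutoff x 1) y⟫) • (EuclideanSpace.single (j : Fin 3) (1 : ℝ)))
  have e2 := norm_add_le (∫ y, biotSavartKernel (x - y) (s₁ y))
    (∫ y, biotSavartKernel (x - y) (s₃ y))
  linarith [e1, e2, hb1, hb3, hb4]

end Summit.NavierStokesRegularity.NavierStokesRegularity.Theorems.FluxZoom.Registered

end
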